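import Summits.BirchSwinnertonDyer.BirchSwinnertonDyer.Theorems.ByReductionTypeAtTwoMultUpperHalfTower
import Summits.BirchSwinnertonDyer.BirchSwinnertonDyer.Theorems.ByReductionTypeAtTwoTowerLayerCert
import HarnessLib

/-!
# Route `ByReductionTypeAtTwo`, crux `MultUpperHalfAtTwo` (item stmt-BirchSwinnertonDyer-19922): the TOWER road of the
# line `four_roads` in tower-1's decidable CERTIFICATE currency, with the local constant AT THE PRIME `2` an
# explicit datum `C₂` — so that a MULTIPLICATIVE `2` (non-split: `C₂ = 4`; split: `C₂ = 2^{ord₂ log₂ q_E − 2}`,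
# Greenberg LNM 1716 §3 pp. 90–93) plugs into the same 60-line per-class instance format as the good-ordinary lane

HONEST FRAMING (cell `bsd-2adic`, run/shared/lean/pub/bsd-2adic/, seat `bsd-2adic-mult-2` GEN 4, HUMAN RULING D-0074
row (A)): research route; THEOREMS ONLY (no definition, no new named fact); nothing is booked; BSD is not proved by any
of this. PARTITION: X5@2 mult (K4ᵐ, RESIDUAL-MAP B1·O1; 1 976 book230 classes) × p = 2 — types-the-object-of (the
per-class certificate format of the TOWER road for the RESIDUAL of the line `four_roads`: 194 = 52 small `2`-adic
image + 142 «neither» rank-`0` classes, and — as an alternative to the integral-Kato MEMO roads (iii)–(vi) — every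
`E[2]`-irreducible multiplicative class); closes none. bears_on: K4 (route-BirchSwinnertonDyer-ByReductionTypeAtTwo
item 19922).

WHY THIS FILE. GEN 3's `Theorems/ByReductionTypeAtTwoMultUpperHalfTower.lean` (p436130) §3 states the TOWER road for a
multiplicative-at-`2` class in tower-1's PLACE currency (`S : Finset (HeightOneSpectrum (𝓞 ℚ))`, `C N : place → ℕ`,
covers `hN`), i.e. the format of tower-1 part 3b — before parts 5–9 (sharp covers p431934, numeric odd-prime constants
p434565, rational-prime currency p435647, decidable certificates p436625) made the good-ordinary per-class file a
60-line affair (`Theorems/ByReductionTypeAtTwoTowerInstance32505h.lean`, `…TowerClass<label>.lean` ×270, seat ord-2).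
Those parts bake in `GoodOrd W 2` through the Lemma-3.4 structure fact `hS34` AT THE PLACE OVER `2`. This file
re-derives parts 7–9 with the constant at `2` an explicit DATUM:

* §1 `towerGapAtTwo_of_layerSelmer_numeric_atTwo` / `…_nat_atTwo` / `…_cert_atTwo` — `O1.TowerGapAtTwo W` for ANY
  globally minimal `W/ℚ` with odd torsion order (no reduction hypothesis at `2`) from PRINT {`h33g`, `hM`, `hA`
  (Greenberg L.3.3 and its p. 88 readings, every layer)} + a displayed bound `h2 : #𝒦_{v,j'}[2] ≤ C₂` at the place
  over `2` + the certificates of tower-1's CERT-SPEC v2 (layer Selmer counts `hlow`/`hup`, odd-prime constants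
  `C ℓ` justified by one disjunct each, `e`/`k` divisibility certificates, and the closed arithmetic
  `2^d · C₂ · ∏_{ℓ ∈ P} C_ℓ^{2^{min(j', e_ℓ)}} < 2^{2^{j'} − 2^j + a}`). At a good ordinary `2` tower-1's doors are the
  case `C₂ = 4` (`hS34`); at a NON-SPLIT multiplicative `2`, `C₂ = 4` (Greenberg p. 93 `|ker(r_v)| ∼ 2c_v`; the
  Literature fact `Greenberg1999.sec3_natCard_localTowerKerPrimary_le_four_nonsplitMultiplicative_two`, proposal
  p444017, review lane — its projection `pTorsion_le_four_of_sec3_nonsplit_two` IS `h2` with `C₂ = 4`); at a SPLIT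
  multiplicative `2`, `C₂ = 2^{ord₂(log₂ q_E) − 2}` (ibid. `…_splitMultiplicative_rat`, projection
  `pTorsion_le_pow_of_sec3_split` with a per-curve certificate on `ord₂ log₂ q_E`). The doors here do not import that
  file (review pending): they DISPLAY `h2`, and the specialisations are one-liners once it lands.
* §2 `missingUpperBoundAt_two_mult_of_layerSelmer_cert_atTwo` — the UPPER HALF `MissingUpperBoundAt W 2` for the whole
  isogeny class of a rank-`0` multiplicative-at-`2` curve from an `E[2]`-IRREDUCIBLE member `W₁` carrying the §1
  certificate: GEN 3's class theorem `missingUpperBoundAt_two_mult_of_towerGapMember'` (PRINT {guarded Thm-4.1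
  analogue `h41ns'`, A236 `h41sp`, modularity, GZK, Cassels, Česnavičius} + MEMO {`hKato` = K11a Kato `⊗ℚ` at a
  multiplicative `2`, RC-2 PASS; `hGS` = Greenberg–Stevens at a split `2`, RC-4 PASS}) ∘ §1. This is what a per-class
  file `…/Theorems/ByReductionTypeAtTwoMultTowerClass<label>.lean` will apply, exactly as ord-2's generator does on the
  good-ordinary side — once tower-eng's engines read layer Selmer counts at a MULTIPLICATIVE `2` (today they assume
  good reduction at `2`: HOME tower/eng/README; WANTED on STATUS).

WHAT IS DISPLAYED, NOT PROVED: PRINT `h33g`/`hM`/`hA` (+ `h41ns'`, `h41sp`, `hmod`, `hGZK`, `hCassels`, `hC` in §2);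
MEMO `hKato` (RC-2), `hGS` (RC-4) in §2; the datum `h2` (PRINT once p444017 lands); CERTIFICATES `hlow`, `hup`
(two tower engines, NOT yet available at a multiplicative `2`), `hr`. ∀-LEVEL CONTENT: none beyond road (i) of the
line (`μ = 0` from the gap, `not_offMuRoad_of_towerGapAtTwo`).

References: R. Greenberg, LNM 1716 (1999), §3 pp. 85–94 (Lemmas 3.3–3.5, Prop. 3.6–3.7), §4 pp. 112–113; K. Kato,
Astérisque 295 (2004), Thm. 17.4, 17.13; L. Washington, *Introduction to Cyclotomic Fields*, §13.1–13.2;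
K. Česnavičius (2018) Thm. 1.2; J. W. S. Cassels, Arithmetic VIII (1965); R. L. Miller, LMS JCM 14 (2011) Def. 1.1.
-/

set_option autoImplicit false
-- the Theorems namespace of this sub repeats the summit name by design (D-0017 nested layout: Summit.<S>.<Sub>)
set_option linter.dupNamespace false

noncomputable section

open scoped Classical MatrixGroups ModularForm

open NumberField IsDedekindDomain CongruenceSubgroup WeierstrassCurve Literature.NumberTheory.EllipticCurves
  Literature.NumberTheory.EllipticCurves.ModularForms
  Literature.NumberTheory.EllipticCurves.Greenberg1999
  Literature.NumberTheory.EllipticCurves.Rank1Residual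
  Literature.NumberTheory.EllipticCurves.Rank1Residual.Typed
  Literature.NumberTheory.GaloisRepresentations
  Summit.BirchSwinnertonDyer.Rank1Residual.X5 Summit.BirchSwinnertonDyer.Rank1Residual.X5.O1
  Summit.BirchSwinnertonDyer.Rank1Residual
  Summit.BirchSwinnertonDyer.BirchSwinnertonDyer.Theorems.KatoHalfPinch
  Rat.HeightOneSpectrum

namespace Summit.BirchSwinnertonDyer.BirchSwinnertonDyer.Theorems.MultTowerCert

/-! ## §1 The gap certificate with the constant at `2` an explicit datum (no reduction hypothesis at `2`) -/

section Gap

variable (W : WeierstrassCurve ℚ) [W.IsElliptic] [W.IsGloballyMinimal]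

omit [W.IsGloballyMinimal] in
/-- **The GAP certificate with NUMERIC local constants, the constant at `2` a DATUM.** `W/ℚ` globally minimal
with odd torsion order (ANY reduction type at `2`); layers `j ≤ j'`; `S` a finite set of finite places off which every
place is odd and good (`hS`); PRINT `h33g`, `hM`, `hA` (Greenberg L.3.3 + p. 88 readings, every layer); a displayed
bound `h2` on `#𝒦_{v,j'}[2]` at the place(s) over `2` by `C₂`; numeric constants `C_v` at the odd `v ∈ S` justified by
ONE disjunct of `hC`; layer counts `hlow`/`hup`; arithmetic
`2^d · ∏_{v ∈ S} (2 ∈ v ? C₂ : C_v)^{(2 ∈ v ? 1 : 2^{min(j', v₂(ℓ_v² − 1) − 3)})} < 2^{2^{j'} − 2^j + a}`. Then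
`O1.TowerGapAtTwo W` (tower-1's `towerGapAtTwo_of_localKernelBounds_sharp`).
[cite: GreenbergLNM1716, §3 Lemmas 3.3–3.5 (PDF pp. 86–90) and pp. 90–93] [cite: Washington1997, §13.1] -/
theorem towerGapAtTwo_of_layerSelmer_numeric_atTwo
    (h33g : lemma33_localTowerKerPrimary_eq_bot_of_good.{0})
    (hM : lemma33_localTowerKerPrimary_cyclic_of_multiplicative.{0})
    (hA : lemma33_natCard_localTowerKerPrimary_le_four_of_additive.{0})
    (htors : ¬ 2 ∣ W.torsionOrder) {j j' a d : ℕ} (hjj' : j ≤ j') (C₂ : ℕ)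
    (h2 : ∀ κ : ZpExtension ℚ 2, κ.IsCyclotomic → ∀ v : HeightOneSpectrum (𝓞 ℚ),
      ((2 : ℕ) : 𝓞 ℚ) ∈ v.asIdeal →
        Finite {x : W.localTowerKerPrimary κ (v.adicCompletion ℚ) j' // 2 • x = 0} ∧
          Nat.card {x : W.localTowerKerPrimary κ (v.adicCompletion ℚ) j' // 2 • x = 0} ≤ C₂)
    (S : Finset (HeightOneSpectrum (𝓞 ℚ)))
    (hS : ∀ v ∉ S, ((2 : ℕ) : 𝓞 ℚ) ∉ v.asIdeal ∧ W.HasGoodReductionAt v)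
    (C : HeightOneSpectrum (𝓞 ℚ) → ℕ)
    (hC : ∀ v ∈ S, ((2 : ℕ) : 𝓞 ℚ) ∉ v.asIdeal →
      4 ≤ C v ∨ (W.HasMultiplicativeReductionAt v ∧ 2 ≤ C v) ∨
        (W.HasMultiplicativeReductionAt v ∧ ¬ 2 ∣ W.ordMinimalDiscriminant v ∧ 1 ≤ C v) ∨
        (W.HasGoodReductionAt v ∧ 1 ≤ C v))
    (hlow : ∀ κ : ZpExtension ℚ 2, κ.IsCyclotomic →
      2 ^ a ≤ Nat.card {z : W.selmerLayer κ j // 2 • z = 0})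
    (hup : ∀ κ : ZpExtension ℚ 2, κ.IsCyclotomic →
      Nat.card {z : W.selmerLayer κ j' // 2 • z = 0} ≤ 2 ^ d)
    (harith : 2 ^ d * ∏ v ∈ S, (if ((2 : ℕ) : 𝓞 ℚ) ∈ v.asIdeal then C₂ else C v) ^
        (if ((2 : ℕ) : 𝓞 ℚ) ∈ v.asIdeal then 1
          else 2 ^ min j' (padicValNat 2 (natGenerator v ^ 2 - 1) - 3)) <
      2 ^ (2 ^ j' - 2 ^ j + a)) : TowerGapAtTwo W := by
  refine towerGapAtTwo_of_localKernelBounds_sharp W htors hjj' S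
    (fun v ↦ if ((2 : ℕ) : 𝓞 ℚ) ∈ v.asIdeal then C₂ else C v) hlow hup
    (fun κ hκ v hv ↦ h33g ℚ W 2 κ hκ v (hS v hv).1 (hS v hv).2 j') (fun κ hκ v hv ↦ ?_) harith
  by_cases h2v : ((2 : ℕ) : 𝓞 ℚ) ∈ v.asIdeal
  · rw [if_pos h2v]
    exact h2 κ hκ v h2v
  · rw [if_neg h2v]
    exact pTorsion_localTowerKer_le_of_numeric W h33g hM hA κ hκ v h2v j' (C v) (hC v hv h2v)

/-- **The GAP certificate indexed by rational primes, the constant at `2` a DATUM.** As tower-1's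
`towerGapAtTwo_of_layerSelmer_nat` (part 8) with `GoodOrd W 2`/`hS34` replaced by the displayed bound `h2` (constant
`C₂`): `P` a finite set of ODD primes containing every odd prime of the minimal discriminant, `C : ℕ → ℕ` justified per
`ℓ ∈ P` by one disjunct, arithmetic `2^d · C₂ · ∏_{ℓ ∈ P} C_ℓ^{2^{min(j', v₂(ℓ² − 1) − 3)}} < 2^{2^{j'} − 2^j + a}`.
[cite: GreenbergLNM1716, §3 Lemmas 3.3–3.5 (PDF pp. 86–90) and pp. 90–93] [cite: SilvermanAEC2009, VII.1 Prop. 1.3, VII.5.1] -/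
theorem towerGapAtTwo_of_layerSelmer_nat_atTwo
    (h33g : lemma33_localTowerKerPrimary_eq_bot_of_good.{0})
    (hM : lemma33_localTowerKerPrimary_cyclic_of_multiplicative.{0})
    (hA : lemma33_natCard_localTowerKerPrimary_le_four_of_additive.{0})
    (htors : ¬ 2 ∣ W.torsionOrder) {j j' a d : ℕ} (hjj' : j ≤ j') (C₂ : ℕ)
    (h2 : ∀ κ : ZpExtension ℚ 2, κ.IsCyclotomic → ∀ v : HeightOneSpectrum (𝓞 ℚ),
      ((2 : ℕ) : 𝓞 ℚ) ∈ v.asIdeal →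
        Finite {x : W.localTowerKerPrimary κ (v.adicCompletion ℚ) j' // 2 • x = 0} ∧
          Nat.card {x : W.localTowerKerPrimary κ (v.adicCompletion ℚ) j' // 2 • x = 0} ≤ C₂)
    (P : Finset ℕ) (hP : ∀ ℓ ∈ P, ℓ.Prime ∧ ℓ ≠ 2)
    (hΔ : ∀ ℓ : ℕ, ℓ.Prime → ℓ ≠ 2 → (ℓ : ℤ) ∣ W.minimalDiscriminantInt → ℓ ∈ P)
    (C : ℕ → ℕ)
    (hC : ∀ (ℓ : ℕ) [Fact ℓ.Prime], ℓ ∈ P →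
      4 ≤ C ℓ ∨ (W.HasMultiplicativeReductionAtPrime ℓ ∧ 2 ≤ C ℓ) ∨
        (W.HasMultiplicativeReductionAtPrime ℓ ∧ ¬ 2 ∣ padicValInt ℓ W.minimalDiscriminantInt ∧
          1 ≤ C ℓ) ∨
        (¬ (ℓ : ℤ) ∣ W.minimalDiscriminantInt ∧ 1 ≤ C ℓ))
    (hlow : ∀ κ : ZpExtension ℚ 2, κ.IsCyclotomic →
      2 ^ a ≤ Nat.card {z : W.selmerLayer κ j // 2 • z = 0})
    (hup : ∀ κ : ZpExtension ℚ 2, κ.IsCyclotomic →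
      Nat.card {z : W.selmerLayer κ j' // 2 • z = 0} ≤ 2 ^ d)
    (harith : 2 ^ d * C₂ * ∏ ℓ ∈ P, C ℓ ^ 2 ^ min j' (padicValNat 2 (ℓ ^ 2 - 1) - 3) <
      2 ^ (2 ^ j' - 2 ^ j + a)) : TowerGapAtTwo W := by
  -- the places (exactly as in tower-1 part 8)
  let pl : ℕ → HeightOneSpectrum (𝓞 ℚ) := fun ℓ ↦
    if h : ℓ.Prime then (primesEquiv (R := 𝓞 ℚ)).symm ⟨ℓ, h⟩
      else (primesEquiv (R := 𝓞 ℚ)).symm ⟨2, Nat.prime_two⟩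
  have hpl : ∀ {ℓ : ℕ}, ℓ.Prime → natGenerator (pl ℓ) = ℓ := fun {ℓ} h ↦ by
    simp only [pl, dif_pos h]
    exact congrArg Subtype.val ((primesEquiv (R := 𝓞 ℚ)).apply_symm_apply ⟨ℓ, h⟩)
  have hpl_inj : Set.InjOn pl P := by
    intro ℓ hℓ ℓ' hℓ' h
    have := congrArg natGenerator h
    rwa [hpl (hP ℓ hℓ).1, hpl (hP ℓ' hℓ').1] at this
  let v₂ : HeightOneSpectrum (𝓞 ℚ) := pl 2
  have hv₂ : natGenerator v₂ = 2 := hpl Nat.prime_two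
  have h2v₂ : ((2 : ℕ) : 𝓞 ℚ) ∈ v₂.asIdeal := (natCast_prime_mem_asIdeal_iff v₂ Nat.prime_two).mpr hv₂
  have hv₂_notMem : v₂ ∉ P.image pl := by
    intro h
    obtain ⟨ℓ, hℓ, hℓeq⟩ := Finset.mem_image.mp h
    have := congrArg natGenerator hℓeq
    rw [hpl (hP ℓ hℓ).1, hv₂] at this
    exact (hP ℓ hℓ).2 this
  -- odd places in the image
  have hodd : ∀ {ℓ : ℕ}, ℓ ∈ P → ((2 : ℕ) : 𝓞 ℚ) ∉ (pl ℓ).asIdeal := fun {ℓ} hℓ h ↦ by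
    rw [natCast_prime_mem_asIdeal_iff _ Nat.prime_two, hpl (hP ℓ hℓ).1] at h
    exact (hP ℓ hℓ).2 h
  let S : Finset (HeightOneSpectrum (𝓞 ℚ)) := insert v₂ (P.image pl)
  let Cv : HeightOneSpectrum (𝓞 ℚ) → ℕ := fun v ↦ C (natGenerator v)
  refine towerGapAtTwo_of_layerSelmer_numeric_atTwo W h33g hM hA htors hjj' C₂ h2 S ?_ Cv ?_ hlow hup ?_
  · -- `hS`: off `S` every place is odd and good
    intro v hv
    have hgen := prime_natGenerator v
    haveI : Fact (natGenerator v).Prime := ⟨hgen⟩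
    have hvpl : pl (natGenerator v) = v := by
      simp only [pl, dif_pos hgen]
      exact (primesEquiv (R := 𝓞 ℚ)).symm_apply_apply v
    have hne2 : natGenerator v ≠ 2 := by
      intro h
      apply hv
      rw [Finset.mem_insert]
      left
      rw [← hvpl]
      simp only [v₂, h]
    have hnotP : natGenerator v ∉ P := by
      intro h
      exact hv (Finset.mem_insert_of_mem (Finset.mem_image.mpr ⟨_, h, hvpl⟩))
    refine ⟨fun h ↦ hne2 ((natCast_prime_mem_asIdeal_iff v Nat.prime_two).mp h), ?_⟩
    have hndvd : ¬ ((natGenerator v : ℕ) : ℤ) ∣ W.minimalDiscriminantInt :=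
      fun h ↦ hnotP (hΔ _ hgen hne2 h)
    exact (hasGoodReductionAtPrime_iff_hasGoodReductionAt_ringOfIntegers (v := v) W).mp
      (hasGoodReductionAtPrime_of_not_dvd W (natGenerator v) hndvd)
  · -- `hC`: the numeric local constants at the odd places of `S`
    intro v hv h2
    rcases Finset.mem_insert.mp hv with rfl | hv'
    · exact absurd h2v₂ h2
    obtain ⟨ℓ, hℓP, rfl⟩ := Finset.mem_image.mp hv'
    have hℓ := (hP ℓ hℓP).1
    haveI : Fact ℓ.Prime := ⟨hℓ⟩
    have hgen : natGenerator (pl ℓ) = ℓ := hpl hℓ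
    haveI : Fact (Nat.Prime ((primesEquiv (pl ℓ) : Nat.Primes) : ℕ)) := ⟨(primesEquiv (pl ℓ)).2⟩
    have hpe : ((primesEquiv (pl ℓ) : Nat.Primes) : ℕ) = ℓ := hgen
    have hCv : Cv (pl ℓ) = C ℓ := by simp only [Cv, hgen]
    rw [hCv]
    rcases hC ℓ hℓP with h4 | ⟨hm, h2C⟩ | ⟨hm, hord, h1⟩ | ⟨hg, h1⟩
    · exact Or.inl h4
    · refine Or.inr (Or.inl ⟨?_, h2C⟩)
      exact (hasMultiplicativeReductionAtPrime_iff_hasMultiplicativeReductionAt_ringOfIntegers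
        (W := W) (pl ℓ)).mp ((hasMultiplicativeReductionAtPrime_congr W hpe).mpr hm)
    · refine Or.inr (Or.inr (Or.inl ⟨?_, ?_, h1⟩))
      · exact (hasMultiplicativeReductionAtPrime_iff_hasMultiplicativeReductionAt_ringOfIntegers
          (W := W) (pl ℓ)).mp ((hasMultiplicativeReductionAtPrime_congr W hpe).mpr hm)
      · rwa [LocalTorsionMult.ordMinimalDiscriminant_eq_padicValInt W (pl ℓ) hpe]
    · refine Or.inr (Or.inr (Or.inr ⟨?_, h1⟩))
      exact (hasGoodReductionAtPrime_iff_hasGoodReductionAt_ringOfIntegers (v := pl ℓ) W).mp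
        ((hasGoodReductionAtPrime_congr W hpe).mpr (hasGoodReductionAtPrime_of_not_dvd W ℓ hg))
  · -- the arithmetic, re-indexed by primes
    have hprod : ∏ v ∈ S, (if ((2 : ℕ) : 𝓞 ℚ) ∈ v.asIdeal then C₂ else Cv v) ^
        (if ((2 : ℕ) : 𝓞 ℚ) ∈ v.asIdeal then 1
          else 2 ^ min j' (padicValNat 2 (natGenerator v ^ 2 - 1) - 3)) =
        C₂ * ∏ ℓ ∈ P, C ℓ ^ 2 ^ min j' (padicValNat 2 (ℓ ^ 2 - 1) - 3) := by
      rw [Finset.prod_insert hv₂_notMem, if_pos h2v₂, if_pos h2v₂, pow_one,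
        Finset.prod_image hpl_inj]
      congr 1
      refine Finset.prod_congr rfl fun ℓ hℓ ↦ ?_
      rw [if_neg (hodd hℓ), if_neg (hodd hℓ)]
      simp only [Cv, hpl (hP ℓ hℓ).1]
    rw [hprod, ← mul_assoc]
    exact harith

/-- **The GAP certificate, every kernel-side datum decidable, the constant at `2` a DATUM.** As tower-1's
`towerGapAtTwo_of_layerSelmer_cert` (part 9) with `GoodOrd W 2`/`hS34` replaced by the displayed bound `h2`
(constant `C₂`): the sharp exponent is `2^{min(j', e_ℓ)}` for a certificate `e` with `¬ 2^{e_ℓ+4} ∣ ℓ² − 1`, the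
`C_ℓ = 1` clause is certified by `ℓ^{k_ℓ} ∣ Δ_min`, `ℓ^{k_ℓ+1} ∤ Δ_min`, `2 ∤ k_ℓ`; arithmetic
`2^d · C₂ · ∏_{ℓ ∈ P} C_ℓ^{2^{min(j', e_ℓ)}} < 2^{2^{j'} − 2^j + a}`.
[cite: GreenbergLNM1716, §3 Lemmas 3.3–3.5 (PDF pp. 86–90) and pp. 90–93] [cite: SilvermanAEC2009, VII.1 Prop. 1.3, VII.5.1] -/
theorem towerGapAtTwo_of_layerSelmer_cert_atTwo
    (h33g : lemma33_localTowerKerPrimary_eq_bot_of_good.{0})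
    (hM : lemma33_localTowerKerPrimary_cyclic_of_multiplicative.{0})
    (hA : lemma33_natCard_localTowerKerPrimary_le_four_of_additive.{0})
    (htors : ¬ 2 ∣ W.torsionOrder) {j j' a d : ℕ} (hjj' : j ≤ j') (C₂ : ℕ)
    (h2 : ∀ κ : ZpExtension ℚ 2, κ.IsCyclotomic → ∀ v : HeightOneSpectrum (𝓞 ℚ),
      ((2 : ℕ) : 𝓞 ℚ) ∈ v.asIdeal →
        Finite {x : W.localTowerKerPrimary κ (v.adicCompletion ℚ) j' // 2 • x = 0} ∧
          Nat.card {x : W.localTowerKerPrimary κ (v.adicCompletion ℚ) j' // 2 • x = 0} ≤ C₂)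
    (P : Finset ℕ) (hP : ∀ ℓ ∈ P, ℓ.Prime ∧ ℓ ≠ 2)
    (hΔ : ∀ ℓ : ℕ, ℓ.Prime → ℓ ≠ 2 → (ℓ : ℤ) ∣ W.minimalDiscriminantInt → ℓ ∈ P)
    (C e k : ℕ → ℕ) (he : ∀ ℓ ∈ P, ¬ 2 ^ (e ℓ + 4) ∣ ℓ ^ 2 - 1)
    (hC : ∀ (ℓ : ℕ) [Fact ℓ.Prime], ℓ ∈ P →
      4 ≤ C ℓ ∨ (W.HasMultiplicativeReductionAtPrime ℓ ∧ 2 ≤ C ℓ) ∨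
        (W.HasMultiplicativeReductionAtPrime ℓ ∧ (ℓ : ℤ) ^ k ℓ ∣ W.minimalDiscriminantInt ∧
          ¬ (ℓ : ℤ) ^ (k ℓ + 1) ∣ W.minimalDiscriminantInt ∧ ¬ 2 ∣ k ℓ ∧ 1 ≤ C ℓ) ∨
        (¬ (ℓ : ℤ) ∣ W.minimalDiscriminantInt ∧ 1 ≤ C ℓ))
    (hlow : ∀ κ : ZpExtension ℚ 2, κ.IsCyclotomic →
      2 ^ a ≤ Nat.card {z : W.selmerLayer κ j // 2 • z = 0})
    (hup : ∀ κ : ZpExtension ℚ 2, κ.IsCyclotomic →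
      Nat.card {z : W.selmerLayer κ j' // 2 • z = 0} ≤ 2 ^ d)
    (harith : 2 ^ d * C₂ * ∏ ℓ ∈ P, C ℓ ^ 2 ^ min j' (e ℓ) < 2 ^ (2 ^ j' - 2 ^ j + a)) :
    TowerGapAtTwo W := by
  -- `1 ≤ C ℓ` on `P`
  have hC1 : ∀ ℓ ∈ P, 1 ≤ C ℓ := by
    intro ℓ hℓ
    haveI : Fact ℓ.Prime := ⟨(hP ℓ hℓ).1⟩
    rcases hC ℓ hℓ with h | ⟨-, h⟩ | ⟨-, -, -, -, h⟩ | ⟨-, h⟩ <;> omega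
  refine towerGapAtTwo_of_layerSelmer_nat_atTwo W h33g hM hA htors hjj' C₂ h2 P hP hΔ C
    (fun ℓ _ hℓ ↦ ?_) hlow hup (lt_of_le_of_lt ?_ harith)
  · rcases hC ℓ hℓ with h | h | ⟨hm, h1, h2', hodd, hC'⟩ | h
    · exact Or.inl h
    · exact Or.inr (Or.inl h)
    · refine Or.inr (Or.inr (Or.inl ⟨hm, ?_, hC'⟩))
      rwa [padicValInt_eq_of_dvd_of_not_dvd h1 h2']
    · exact Or.inr (Or.inr (Or.inr h))
  · refine Nat.mul_le_mul_left _ (Finset.prod_le_prod (fun ℓ _ ↦ Nat.zero_le _) fun ℓ hℓ ↦ ?_)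
    refine Nat.pow_le_pow_right (hC1 ℓ hℓ) (Nat.pow_le_pow_right (by norm_num) ?_)
    have hℓ2 : ℓ ^ 2 - 1 ≠ 0 := by
      have h3 : 2 ≤ ℓ := (hP ℓ hℓ).1.two_le
      have : 4 ≤ ℓ ^ 2 := by nlinarith
      omega
    exact min_le_min_left _ (padicValNat_sq_sub_one_sub_three_le hℓ2 (he ℓ hℓ))

end Gap

/-! ## §2 The UPPER HALF for a multiplicative-at-`2` class from an irreducible member's certificate -/

section UpperHalf

/-- **ROAD (tower) for the class, CERT currency, constant at `2` a DATUM — what a per-class instance file applies.**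
For `W/ℚ` of analytic rank `0` MULTIPLICATIVE at `2` and a `ℚ`-isogenous globally minimal member `W₁` with `E₁[2]`
IRREDUCIBLE (period datum then PRINT, torsion order odd): GEN 3's class theorem
`missingUpperBoundAt_two_mult_of_towerGapMember'` (PRINT {guarded Thm-4.1 analogue `h41ns'`, A236 `h41sp`, `hmod`,
`hGZK`, `hCassels`, Česnavičius `hC`} + MEMO {`hKato` Kato `⊗ℚ` at a multiplicative `2`, RC-2; `hGS`
Greenberg–Stevens at a split `2`, RC-4}) with the tower-gap certificate at `W₁` DISCHARGED by
`towerGapAtTwo_of_layerSelmer_cert_atTwo`: PRINT {`h33g`, `hM`, `hA`}, the displayed bound `h2` at the place over `2`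
(`C₂ = 4` at a non-split `2`, `2^{ord₂ log₂ q_{E₁} − 2}` at a split `2` — Greenberg §3 pp. 90–93), and the
decidable certificates {`P`, `C`, `e`, `k`, `hlow`, `hup`, arithmetic}. Conclusion: `MissingUpperBoundAt W 2` at EVERY
member of the class (Cassels). [cite: GreenbergLNM1716, §3 pp. 85–94 and §4 pp. 112–113] [cite: Washington1997, §13.2]
[cite: Cesnavicius2018, Thm. 1.2] [cite: Cassels1965ArithmeticVIII] [cite: Miller2011LMS, Def. 1.1] -/
theorem missingUpperBoundAt_two_mult_of_layerSelmer_cert_atTwo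
    (hKato : ∀ (W : WeierstrassCurve ℚ) [W.IsElliptic] [W.IsGloballyMinimal],
      ¬ W.HasCM → Mult W 2 → O1.KatoMultiplicativeDivisibilityRat W 2)
    (h41ns' : thm41Analogue_charValue_rankZero_numberField_anyPrime_oddLocalDegree)
    (h41sp : thm41Analogue_charValue_rankZero_split_baseChange_anyPrime)
    (hmod : nonempty_modularParametrizationData)
    (hGZK : rank_eq_analyticRank_of_analyticRank_le_one)
    (hCassels : bsdRHS_eq_of_isIsogenous)
    (hC : cesnavicius_not_two_dvd_maninConstant_of_two_dvd_level)
    (hGS : ∀ (W : WeierstrassCurve ℚ) [W.IsElliptic] [W.IsGloballyMinimal],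
      W.HasSplitMultiplicativeReductionAtPrime 2 → greenberg_stevens (W := W) (p := 2))
    (h33g : lemma33_localTowerKerPrimary_eq_bot_of_good.{0})
    (hM : lemma33_localTowerKerPrimary_cyclic_of_multiplicative.{0})
    (hA : lemma33_natCard_localTowerKerPrimary_le_four_of_additive.{0})
    (W : WeierstrassCurve ℚ) [W.IsElliptic] [W.IsGloballyMinimal]
    (hr : W.analyticRank = 0) (hmult : Mult W 2)
    (W₁ : WeierstrassCurve ℚ) [W₁.IsElliptic] [W₁.IsGloballyMinimal] (hiso : IsIsogenous W W₁)
    (hirr : Irr W₁ 2) {j j' a d : ℕ} (hjj' : j ≤ j') (C₂ : ℕ)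
    (h2 : ∀ κ : ZpExtension ℚ 2, κ.IsCyclotomic → ∀ v : HeightOneSpectrum (𝓞 ℚ),
      ((2 : ℕ) : 𝓞 ℚ) ∈ v.asIdeal →
        Finite {x : W₁.localTowerKerPrimary κ (v.adicCompletion ℚ) j' // 2 • x = 0} ∧
          Nat.card {x : W₁.localTowerKerPrimary κ (v.adicCompletion ℚ) j' // 2 • x = 0} ≤ C₂)
    (P : Finset ℕ) (hP : ∀ ℓ ∈ P, ℓ.Prime ∧ ℓ ≠ 2)
    (hΔ : ∀ ℓ : ℕ, ℓ.Prime → ℓ ≠ 2 → (ℓ : ℤ) ∣ W₁.minimalDiscriminantInt → ℓ ∈ P)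
    (C e k : ℕ → ℕ) (he : ∀ ℓ ∈ P, ¬ 2 ^ (e ℓ + 4) ∣ ℓ ^ 2 - 1)
    (hCℓ : ∀ (ℓ : ℕ) [Fact ℓ.Prime], ℓ ∈ P →
      4 ≤ C ℓ ∨ (W₁.HasMultiplicativeReductionAtPrime ℓ ∧ 2 ≤ C ℓ) ∨
        (W₁.HasMultiplicativeReductionAtPrime ℓ ∧ (ℓ : ℤ) ^ k ℓ ∣ W₁.minimalDiscriminantInt ∧
          ¬ (ℓ : ℤ) ^ (k ℓ + 1) ∣ W₁.minimalDiscriminantInt ∧ ¬ 2 ∣ k ℓ ∧ 1 ≤ C ℓ) ∨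
        (¬ (ℓ : ℤ) ∣ W₁.minimalDiscriminantInt ∧ 1 ≤ C ℓ))
    (hlow : ∀ κ : ZpExtension ℚ 2, κ.IsCyclotomic →
      2 ^ a ≤ Nat.card {z : W₁.selmerLayer κ j // 2 • z = 0})
    (hup : ∀ κ : ZpExtension ℚ 2, κ.IsCyclotomic →
      Nat.card {z : W₁.selmerLayer κ j' // 2 • z = 0} ≤ 2 ^ d)
    (harith : 2 ^ d * C₂ * ∏ ℓ ∈ P, C ℓ ^ 2 ^ min j' (e ℓ) < 2 ^ (2 ^ j' - 2 ^ j + a)) :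
    MissingUpperBoundAt W 2 :=
  missingUpperBoundAt_two_mult_of_towerGapMember' hKato h41ns' h41sp hmod hGZK hCassels hC hGS W hr hmult W₁ hiso
    (towerGapAtTwo_of_layerSelmer_cert_atTwo W₁ h33g hM hA (not_two_dvd_torsionOrder_of_irr_two W₁ hirr) hjj' C₂ h2
      P hP hΔ C e k he hCℓ hlow hup harith)
    (Or.inl hirr)

/-- **The same at the curve itself** (`W₁ = W`, isogeny reflexive): the per-class file of a single-member or
`E[2]`-irreducible class applies this. [cite: GreenbergLNM1716, §3 pp. 85–94 and §4 pp. 112–113]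
[cite: SilvermanAEC2009, III.4 (isogeny reflexive)] [cite: Miller2011LMS, Def. 1.1] -/
theorem missingUpperBoundAt_two_mult_of_layerSelmer_cert_atTwo_self
    (hKato : ∀ (W : WeierstrassCurve ℚ) [W.IsElliptic] [W.IsGloballyMinimal],
      ¬ W.HasCM → Mult W 2 → O1.KatoMultiplicativeDivisibilityRat W 2)
    (h41ns' : thm41Analogue_charValue_rankZero_numberField_anyPrime_oddLocalDegree)
    (h41sp : thm41Analogue_charValue_rankZero_split_baseChange_anyPrime)
    (hmod : nonempty_modularParametrizationData)
    (hGZK : rank_eq_analyticRank_of_analyticRank_le_one)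
    (hCassels : bsdRHS_eq_of_isIsogenous)
    (hC : cesnavicius_not_two_dvd_maninConstant_of_two_dvd_level)
    (hGS : ∀ (W : WeierstrassCurve ℚ) [W.IsElliptic] [W.IsGloballyMinimal],
      W.HasSplitMultiplicativeReductionAtPrime 2 → greenberg_stevens (W := W) (p := 2))
    (h33g : lemma33_localTowerKerPrimary_eq_bot_of_good.{0})
    (hM : lemma33_localTowerKerPrimary_cyclic_of_multiplicative.{0})
    (hA : lemma33_natCard_localTowerKerPrimary_le_four_of_additive.{0})
    (W : WeierstrassCurve ℚ) [W.IsElliptic] [W.IsGloballyMinimal]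
    (hr : W.analyticRank = 0) (hmult : Mult W 2) (hirr : Irr W 2) {j j' a d : ℕ} (hjj' : j ≤ j') (C₂ : ℕ)
    (h2 : ∀ κ : ZpExtension ℚ 2, κ.IsCyclotomic → ∀ v : HeightOneSpectrum (𝓞 ℚ),
      ((2 : ℕ) : 𝓞 ℚ) ∈ v.asIdeal →
        Finite {x : W.localTowerKerPrimary κ (v.adicCompletion ℚ) j' // 2 • x = 0} ∧
          Nat.card {x : W.localTowerKerPrimary κ (v.adicCompletion ℚ) j' // 2 • x = 0} ≤ C₂)
    (P : Finset ℕ) (hP : ∀ ℓ ∈ P, ℓ.Prime ∧ ℓ ≠ 2)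
    (hΔ : ∀ ℓ : ℕ, ℓ.Prime → ℓ ≠ 2 → (ℓ : ℤ) ∣ W.minimalDiscriminantInt → ℓ ∈ P)
    (C e k : ℕ → ℕ) (he : ∀ ℓ ∈ P, ¬ 2 ^ (e ℓ + 4) ∣ ℓ ^ 2 - 1)
    (hCℓ : ∀ (ℓ : ℕ) [Fact ℓ.Prime], ℓ ∈ P →
      4 ≤ C ℓ ∨ (W.HasMultiplicativeReductionAtPrime ℓ ∧ 2 ≤ C ℓ) ∨
        (W.HasMultiplicativeReductionAtPrime ℓ ∧ (ℓ : ℤ) ^ k ℓ ∣ W.minimalDiscriminantInt ∧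
          ¬ (ℓ : ℤ) ^ (k ℓ + 1) ∣ W.minimalDiscriminantInt ∧ ¬ 2 ∣ k ℓ ∧ 1 ≤ C ℓ) ∨
        (¬ (ℓ : ℤ) ∣ W.minimalDiscriminantInt ∧ 1 ≤ C ℓ))
    (hlow : ∀ κ : ZpExtension ℚ 2, κ.IsCyclotomic →
      2 ^ a ≤ Nat.card {z : W.selmerLayer κ j // 2 • z = 0})
    (hup : ∀ κ : ZpExtension ℚ 2, κ.IsCyclotomic →
      Nat.card {z : W.selmerLayer κ j' // 2 • z = 0} ≤ 2 ^ d)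
    (harith : 2 ^ d * C₂ * ∏ ℓ ∈ P, C ℓ ^ 2 ^ min j' (e ℓ) < 2 ^ (2 ^ j' - 2 ^ j + a)) :
    MissingUpperBoundAt W 2 :=
  missingUpperBoundAt_two_mult_of_layerSelmer_cert_atTwo hKato h41ns' h41sp hmod hGZK hCassels hC hGS h33g hM hA W hr
    hmult W (IsIsogenous.refl_holds W) hirr hjj' C₂ h2 P hP hΔ C e k he hCℓ hlow hup harith

end UpperHalf

end Summit.BirchSwinnertonDyer.BirchSwinnertonDyer.Theorems.MultTowerCert

end
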